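import Mathlib
import HarnessLib
import Summits.HubbardSuperconductivity.HubbardSuperconductivity.Theorems.KLProgrammeC4aCausticWindowCoverTransversal
import Summits.HubbardSuperconductivity.HubbardSuperconductivity.Theorems.KLProgrammeC4aCausticWindowDispatchTransversal
import Summits.HubbardSuperconductivity.HubbardSuperconductivity.Theorems.KLProgrammeC4aCausticWindowDispatchPartnerBand

/-!
# Route `KLProgramme` — crux C4a, S3 brick (B4) «(B4)-UMK1», «(M4)-COVER» part 3: EVERY NEAR-CAUSTIC ϑ-WINDOW OF THE UMKLAPP FIRST-ORDER LAYER IS ONE CALL —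
# the transversal and the antipodal window from the near-caustic witness alone, and the COVER theorem `∫_α^β F ≤ max(b_trans, b_anti)` (no case datum)

Cell `gate-hubbard-kl`, seat hubbard-kl-k3c3-p3 (g30; row «implicit-function / monotonicity route for μ(n)»).  Located brick for the (C)-closer lane hubbard-kl-c4a-1
(stub (C) `stub_twoLeg_curvature` of `KLRegimeEngineV17F2`, stmt-HubbardSuperconductivity-20437), memo HOME/hubbard-kl-k3c3-p3/U1-CAUSTIC-SUP.md §9 (3)–(4).
Composition of parts 1–2 (`…C4aCausticWindowCover(Transversal)`: the geometry of a near-caustic box) with the two landed window engines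
(`…C4aCausticWindowDispatchTransversal.intervalIntegral_caustic_dispatch_transversal_le`, `…C4aCausticWindowDispatchPartnerBand.intervalIntegral_caustic_dispatch_partnerBand_sInf_le`):
* §1 **`intervalIntegral_caustic_antipodal_of_nearCaustic_le`**: `FrameOK`, `|ρ| < r`, base point `c`, box `[α,β] × [φa,φb]` with a near-caustic witness
  `‖c + Φ(ρ,ϑ₁+θ) − 2Φ(0,φ₁+θ)‖ ≤ τ₀` whose `q′`-angle is ANTIPODAL to the loop angle within `η₀` (`‖ϑ₁ − φ₁ − π‖_𝕋 ≤ η₀`); thresholds `Δ ≥ τ₀ + msD₁((β−α)+(φb−φa))`,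
  `ω ≥ η₀ + (β−α)`, `ω ≥ φb − φa` under the budget `2ε(Δ,|ρ|,ω) < (9/400)u_min²`; the pre/post laws keyed to the SIGN of the canonical offset
  `δ₀(ϑ) = inf_{φ ∈ [φa,φb]} e_K(c + Φ(ρ,ϑ+θ) − Φ(0,φ+θ))` ⟹ `∫_α^β F ≤ (8A′ + 4P)/√(κ₀/2) + B(β − α) + ∫R` — the `2π`-shift of the loop window is internal;
* §2 **`intervalIntegral_caustic_transversal_of_nearCaustic_le`**: `GeomConstants` (= `FrameOK` (i)), `|ρ| < r, r₀`, the same witness with BOTH torus distances `≥ η₀`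
  (TRANSVERSAL), `Δ ≤ 3/10`, `K₁Δ < r`, `κ := κ(η₀ − (β−α), Δ, |ρ|) > 0`, `κ(β−α) ≤ Γ`, the two-sided law in offset currency ⟹ p670377's bound with `κ₁ = κ`;
* §3 **THE COVER THEOREM `intervalIntegral_caustic_nearCaustic_umklapp_le`**: on an umklapp sheet `m ≠ 0` (`c = Φ(0,θ) − 2πm`), with the same-direction budget
  `τ₀ + 2(msD₁η₀ + |ρ|/(Dt−2A)) ≤ 3/5`, a near-caustic window satisfies `∫_α^β F ≤ max(b_trans, b_anti)` — the trichotomy (`not_nearCaustic_sameDirection` /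
  §2 / §1) is decided inside; the caller supplies thresholds and laws only, never a case.
Bookkeeping on landed objects; nothing about the model's sizes beyond `FrameOK`; nothing asserts (C), K3 or superconductivity.
References: Salmhofer 1999 §4.5.3 [cite: Salmhofer1999]; FST II CPAM 51 (1998) §3 [cite: FeldmanSalmhoferTrubowitz1998]; BGM 2003 §7.1 Lemma 7.1
[cite: BenfattoGiulianiMastropietro2003].
-/

noncomputable section

namespace Summit.HubbardSuperconductivity.HubbardSuperconductivity.Theorems.C4a

set_option linter.dupNamespace false -- summit = problem name (single-conjunct summit), D-0017
set_option maxSynthPendingDepth 3 -- nested operator-norm instances (third Fréchet derivatives)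

open Real Set Filter MeasureTheory intervalIntegral
open scoped Topology
open Literature.MathematicalPhysics.QuantumLattice Literature.MathematicalPhysics.QuantumLattice.BandSectorCounting Literature.Probability.LatticeModels
open Literature.MathematicalPhysics.QuantumLattice.FermiRG
open Summit.HubbardSuperconductivity.HubbardSuperconductivity.Theorems.KLRegimeSplit
open Summit.HubbardSuperconductivity.HubbardSuperconductivity.Theorems.DispersionFlow
open Summit.HubbardSuperconductivity.HubbardSuperconductivity.Theorems.PerturbedFermiCurve

section Sizes

variable {K : TrigPolyC4v} {A : ℝ} (hA : ∀ p : Momentum, ∀ j ≤ 2, ‖iteratedFDeriv ℝ j (frameShift K) p‖ ≤ A) (hA20 : A ≤ 1 / 20)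
  (hd : klCurveD ≤ (bandBounds (show (-4 : ℝ) < -1.1 by norm_num) (show (-1.1 : ℝ) ≤ -0.1 by norm_num)
    (show (-0.1 : ℝ) < 0 by norm_num)).Dtmin - 2 * A)
  {μ r : ℝ} (hr : 0 < r) (hlo : (-1.1 : ℝ) < μ - r - A) (hhi : μ + r + A < -0.1)
  {A₃ A₄ : ℝ} (hA₃ : ∀ p : Momentum, ‖iteratedFDeriv ℝ 3 (frameShift K) p‖ ≤ A₃)
  (hA₄ : ∀ p : Momentum, ‖iteratedFDeriv ℝ 4 (frameShift K) p‖ ≤ A₄)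
  {K₁ K₂ K₃ : ℝ} (hK₁ : ∀ p : Momentum, ‖fderiv ℝ (frameLevel μ K) p‖ ≤ K₁) (hK₂ : ∀ p : Momentum, ‖iteratedFDeriv ℝ 2 (frameLevel μ K) p‖ ≤ K₂)
  (hK₃ : ∀ p : Momentum, ‖iteratedFDeriv ℝ 3 (frameLevel μ K) p‖ ≤ K₃)
include hA hA20 hd hr hlo hhi hA₃ hA₄ hK₁ hK₂ hK₃

/-! ## §1 The antipodal window from the near-caustic witness -/

/-- **THE ANTIPODAL NEAR-CAUSTIC WINDOW IN ONE CALL.**  `FrameOK`, `|ρ| < r`, base point `c`, base angle `θ`; box `[α,β] × [φa,φb]` containing a witness `(ϑ₁,φ₁)`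
with `‖c + Φ(ρ,ϑ₁+θ) − Φ(0,φ₁+θ) − Φ(0,φ₁+θ)‖ ≤ τ₀` and `‖ϑ₁ − φ₁ − π‖_𝕋 ≤ η₀`; thresholds `Δ, ω` dominating `τ₀ + msD₁((β−α)+(φb−φa))`, `η₀ + (β−α)`, `φb − φa`
under the window budget of `intervalIntegral_caustic_dispatch_partnerBand_le`; the pre law WHERE the canonical offset is `> 0` and the log-free post law WHERE it
is `< 0`.  THEN `∫_α^β F ≤ (8A′ + 4P)/√(κ₀/2) + B(β − α) + ∫_α^β R`, `κ₀ = (9/400)u_min² − 2ε(Δ, |ρ|, ω)`. -/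
theorem intervalIntegral_caustic_antipodal_of_nearCaustic_le {R : RenConsts} {U : ℝ} {N : ℕ} (hF : FrameOK R U N μ K) {ρ : ℝ} (hρ : |ρ| < r)
    (c : Momentum) (θ : ℝ) {α β φa φb ϑ₁ φ₁ τ₀ η₀ Δ ω : ℝ} (hαβ : α ≤ β) (hφ : φa ≤ φb) (hϑ₁ : ϑ₁ ∈ Icc α β) (hφ₁ : φ₁ ∈ Icc φa φb)
    (hτ : ‖c + (levelPoint μ K ρ (ϑ₁ + θ) - levelPoint μ K 0 (φ₁ + θ)) - levelPoint μ K 0 (φ₁ + θ)‖ ≤ τ₀)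
    (hanti : torusDist (ϑ₁ - φ₁ - π) ≤ η₀)
    (hΔ : τ₀ + msD A₃ A₄ 1 * ((β - α) + (φb - φa)) ≤ Δ) (hω₁ : η₀ + (β - α) ≤ ω) (hω₂ : φb - φa ≤ ω)
    (hbudget : 2 * (2 * K₃ * Δ * msD A₃ A₄ 1 ^ 2 +
        4 * K₂ * (radialRowOneConst A ((bandBounds (show (-4 : ℝ) < -1.1 by norm_num) (show (-1.1 : ℝ) ≤ -0.1 by norm_num) (show (-0.1 : ℝ) < 0 by norm_num)).Dtmin - 2 * A) * |ρ| +
          msD A₃ A₄ 2 * ω) * msD A₃ A₄ 1 +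
        K₂ * Δ * msD A₃ A₄ 2 +
        K₁ * ((uRowTwoConst A A₃ ((bandBounds (show (-4 : ℝ) < -1.1 by norm_num) (show (-1.1 : ℝ) ≤ -0.1 by norm_num) (show (-0.1 : ℝ) < 0 by norm_num)).Dtmin - 2 * A) +
              1 / ((bandBounds (show (-4 : ℝ) < -1.1 by norm_num) (show (-1.1 : ℝ) ≤ -0.1 by norm_num) (show (-0.1 : ℝ) < 0 by norm_num)).Dtmin - 2 * A) +
              2 * (radialRowOneConst A ((bandBounds (show (-4 : ℝ) < -1.1 by norm_num) (show (-1.1 : ℝ) ≤ -0.1 by norm_num) (show (-0.1 : ℝ) < 0 by norm_num)).Dtmin - 2 * A) -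
                1 / ((bandBounds (show (-4 : ℝ) < -1.1 by norm_num) (show (-1.1 : ℝ) ≤ -0.1 by norm_num) (show (-0.1 : ℝ) < 0 by norm_num)).Dtmin - 2 * A))) * |ρ| +
            msD A₃ A₄ 3 * ω)) <
      9 / 400 * (bandBounds (show (-4 : ℝ) < -1.1 by norm_num) (show (-1.1 : ℝ) ≤ -0.1 by norm_num) (show (-0.1 : ℝ) < 0 by norm_num)).umin ^ 2)
    {F Rm : ℝ → ℝ} {lo A' P B : ℝ} (hlo' : 0 < lo) (hA' : 0 ≤ A') (hP : 0 ≤ P) (hB : 0 ≤ B)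
    (hF0 : ∀ ϑ ∈ Icc α β, 0 ≤ F ϑ) (hR0 : ∀ ϑ ∈ Icc α β, 0 ≤ Rm ϑ) (hRi : IntervalIntegrable Rm volume α β)
    (hpre : ∀ ϑ ∈ Ioo α β, 0 < sInf ((fun φ => frameLevel μ K (c + (levelPoint μ K ρ (ϑ + θ) - levelPoint μ K 0 (φ + θ)))) '' Icc φa φb) →
      F ϑ ≤ A' * (lo * ((max |sInf ((fun φ => frameLevel μ K (c + (levelPoint μ K ρ (ϑ + θ) - levelPoint μ K 0 (φ + θ)))) '' Icc φa φb)| lo)⁻¹ *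
        (Real.sqrt (max |sInf ((fun φ => frameLevel μ K (c + (levelPoint μ K ρ (ϑ + θ) - levelPoint μ K 0 (φ + θ)))) '' Icc φa φb)| lo))⁻¹)) + B + Rm ϑ)
    (hpost : ∀ ϑ ∈ Ioo α β, sInf ((fun φ => frameLevel μ K (c + (levelPoint μ K ρ (ϑ + θ) - levelPoint μ K 0 (φ + θ)))) '' Icc φa φb) < 0 →
      F ϑ ≤ P * (Real.sqrt |sInf ((fun φ => frameLevel μ K (c + (levelPoint μ K ρ (ϑ + θ) - levelPoint μ K 0 (φ + θ)))) '' Icc φa φb)|)⁻¹ + B + Rm ϑ) :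
    ∫ ϑ in α..β, F ϑ ≤ (8 * A' + 4 * P) / Real.sqrt ((9 / 400 * (bandBounds (show (-4 : ℝ) < -1.1 by norm_num) (show (-1.1 : ℝ) ≤ -0.1 by norm_num) (show (-0.1 : ℝ) < 0 by norm_num)).umin ^ 2 -
        2 * (2 * K₃ * Δ * msD A₃ A₄ 1 ^ 2 +
          4 * K₂ * (radialRowOneConst A ((bandBounds (show (-4 : ℝ) < -1.1 by norm_num) (show (-1.1 : ℝ) ≤ -0.1 by norm_num) (show (-0.1 : ℝ) < 0 by norm_num)).Dtmin - 2 * A) * |ρ| +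
            msD A₃ A₄ 2 * ω) * msD A₃ A₄ 1 +
          K₂ * Δ * msD A₃ A₄ 2 +
          K₁ * ((uRowTwoConst A A₃ ((bandBounds (show (-4 : ℝ) < -1.1 by norm_num) (show (-1.1 : ℝ) ≤ -0.1 by norm_num) (show (-0.1 : ℝ) < 0 by norm_num)).Dtmin - 2 * A) +
                1 / ((bandBounds (show (-4 : ℝ) < -1.1 by norm_num) (show (-1.1 : ℝ) ≤ -0.1 by norm_num) (show (-0.1 : ℝ) < 0 by norm_num)).Dtmin - 2 * A) +
                2 * (radialRowOneConst A ((bandBounds (show (-4 : ℝ) < -1.1 by norm_num) (show (-1.1 : ℝ) ≤ -0.1 by norm_num) (show (-0.1 : ℝ) < 0 by norm_num)).Dtmin - 2 * A) -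
                  1 / ((bandBounds (show (-4 : ℝ) < -1.1 by norm_num) (show (-1.1 : ℝ) ≤ -0.1 by norm_num) (show (-0.1 : ℝ) < 0 by norm_num)).Dtmin - 2 * A))) * |ρ| +
              msD A₃ A₄ 3 * ω))) / 2) +
      B * (β - α) + ∫ ϑ in α..β, Rm ϑ := by
  -- the shift and the three rows
  obtain ⟨j, hΔ', hω₁', hω₂'⟩ := exists_antipodal_rows_of_nearCaustic hA hA20 hd hlo hhi hA₃ hA₄ hρ c θ hϑ₁ hφ₁ hτ hanti
  set ψ' : ℝ := φ₁ + θ + 2 * π * j with hψ'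
  have hφ' : φa + 2 * π * j ≤ φb + 2 * π * j := by linarith
  have hΔ'' : ∀ x ∈ Icc α β ×ˢ Icc (φa + 2 * π * j) (φb + 2 * π * j),
      ‖c + (levelPoint μ K ρ (x.1 + θ) - levelPoint μ K 0 (x.2 + θ)) - levelPoint μ K 0 ψ'‖ ≤ Δ := fun x hx => (hΔ' x hx).trans hΔ
  have hω₁'' : ∀ ϑ ∈ Icc α β, |ϑ + θ - (ψ' + π)| ≤ ω := fun ϑ hϑ => (hω₁' ϑ hϑ).trans hω₁
  have hω₂'' : ∀ φ ∈ Icc (φa + 2 * π * j) (φb + 2 * π * j), |φ + θ - ψ'| ≤ ω := fun φ hφ'' => (hω₂' φ hφ'').trans hω₂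
  -- the laws, keyed to the offset over the SHIFTED window (= the offset over the original window)
  have hshift : ∀ ϑ : ℝ, sInf ((fun φ => frameLevel μ K (c + (levelPoint μ K ρ (ϑ + θ) - levelPoint μ K 0 (φ + θ)))) '' Icc (φa + 2 * π * j) (φb + 2 * π * j)) =
      sInf ((fun φ => frameLevel μ K (c + (levelPoint μ K ρ (ϑ + θ) - levelPoint μ K 0 (φ + θ)))) '' Icc φa φb) := fun ϑ =>
    sInf_partnerBand_image_Icc_add_shift ρ c θ ϑ φa φb j
  have hpre' : ∀ ϑ ∈ Ioo α β, 0 < sInf ((fun φ => frameLevel μ K (c + (levelPoint μ K ρ (ϑ + θ) - levelPoint μ K 0 (φ + θ)))) '' Icc (φa + 2 * π * j) (φb + 2 * π * j)) →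
      F ϑ ≤ A' * (lo * ((max |sInf ((fun φ => frameLevel μ K (c + (levelPoint μ K ρ (ϑ + θ) - levelPoint μ K 0 (φ + θ)))) '' Icc (φa + 2 * π * j) (φb + 2 * π * j))| lo)⁻¹ *
        (Real.sqrt (max |sInf ((fun φ => frameLevel μ K (c + (levelPoint μ K ρ (ϑ + θ) - levelPoint μ K 0 (φ + θ)))) '' Icc (φa + 2 * π * j) (φb + 2 * π * j))| lo))⁻¹)) +
        B + Rm ϑ := fun ϑ hϑ => by rw [hshift ϑ]; exact hpre ϑ hϑ
  have hpost' : ∀ ϑ ∈ Ioo α β, sInf ((fun φ => frameLevel μ K (c + (levelPoint μ K ρ (ϑ + θ) - levelPoint μ K 0 (φ + θ)))) '' Icc (φa + 2 * π * j) (φb + 2 * π * j)) < 0 →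
      F ϑ ≤ P * (Real.sqrt |sInf ((fun φ => frameLevel μ K (c + (levelPoint μ K ρ (ϑ + θ) - levelPoint μ K 0 (φ + θ)))) '' Icc (φa + 2 * π * j) (φb + 2 * π * j))|)⁻¹ +
        B + Rm ϑ := fun ϑ hϑ => by rw [hshift ϑ]; exact hpost ϑ hϑ
  exact intervalIntegral_caustic_dispatch_partnerBand_sInf_le hA hA20 hd hr hlo hhi hA₃ hA₄ hK₁ hK₂ hK₃ hF hρ c θ ψ' hαβ hφ' hΔ'' hω₁'' hω₂'' hbudget
    hlo' hA' hP hB hF0 hR0 hRi hpre' hpost'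

/-! ## §2 The transversal window from the near-caustic witness -/

omit hA20 hr hA₃ hA₄ hK₁ hK₂ hK₃ in
/-- The canonical offset `ϑ ↦ inf_{φ ∈ [φa,φb]} e_K(c + Φ(ρ,ϑ+θ) − Φ(0,φ+θ))` is continuous (compact window, jointly continuous family). -/
theorem continuousOn_sInf_partnerBand {ρ : ℝ} (hρ : |ρ| < r) (c : Momentum) (θ φa φb : ℝ) (S : Set ℝ) :
    ContinuousOn (fun ϑ => sInf ((fun φ => frameLevel μ K (c + (levelPoint μ K ρ (ϑ + θ) - levelPoint μ K 0 (φ + θ)))) '' Icc φa φb)) S := by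
  have hr' : 0 < r := lt_of_le_of_lt (abs_nonneg ρ) hρ
  have h0 : |(0 : ℝ)| < r := by simpa using hr'
  have hcρ : Continuous (levelPoint μ K ρ) := (contDiff_levelPoint_of_sizes hA hd hlo hhi hρ 0).continuous
  have hc0 : Continuous (levelPoint μ K 0) := (contDiff_levelPoint_of_sizes hA hd hlo hhi h0 0).continuous
  set g : ℝ → ℝ → ℝ := fun ϑ φ => frameLevel μ K (c + (levelPoint μ K ρ (ϑ + θ) - levelPoint μ K 0 (φ + θ))) with hg
  have hjoint : Continuous ↿g := by
    have h1 : Continuous fun p : ℝ × ℝ => c + (levelPoint μ K ρ (p.1 + θ) - levelPoint μ K 0 (p.2 + θ)) :=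
      continuous_const.add ((hcρ.comp (continuous_fst.add continuous_const)).sub (hc0.comp (continuous_snd.add continuous_const)))
    exact (EngineV8.contDiff_frameLevel μ K (n := 0)).continuous.comp h1
  exact ((isCompact_Icc).continuous_sInf hjoint).continuousOn

omit hA hA20 hd hr hlo hhi hA₃ hA₄ hK₁ hK₂ hK₃ in
/-- From the torus data at the witness to the angular separation on the window: if `η₀ ≤ min(‖ϑ₁ − φ₁‖_𝕋, ‖ϑ₁ − φ₁ − π‖_𝕋)` and `ϑ₁ ∈ [α,β]`, then with `ψ = φ₁ + θ`,
`η₀ − (β − α) ≤ min(‖ψ − (ϑ+θ)‖_𝕋, ‖ψ − (ϑ+θ) − π‖_𝕋)` for every `ϑ ∈ [α,β]`. -/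
theorem angularSeparation_of_witness {α β ϑ₁ φ₁ θ η₀ : ℝ} (hϑ₁ : ϑ₁ ∈ Icc α β)
    (htrans : η₀ ≤ min (torusDist (ϑ₁ - φ₁)) (torusDist (ϑ₁ - φ₁ - π))) :
    ∀ ϑ ∈ Icc α β, η₀ - (β - α) ≤ min (torusDist (φ₁ + θ - (ϑ + θ))) (torusDist (φ₁ + θ - (ϑ + θ) - π)) := by
  intro ϑ hϑ
  have h1 : |ϑ - ϑ₁| ≤ β - α := abs_sub_le_iff.2 ⟨by linarith [hϑ.2, hϑ₁.1], by linarith [hϑ.1, hϑ₁.2]⟩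
  have h := min_torusDist_add_ge_abs (ϑ₁ - φ₁) (ϑ - ϑ₁)
  have e1 : torusDist (φ₁ + θ - (ϑ + θ)) = torusDist (ϑ₁ - φ₁ + (ϑ - ϑ₁)) := by
    rw [show φ₁ + θ - (ϑ + θ) = -(ϑ₁ - φ₁ + (ϑ - ϑ₁)) by ring, torusDist_neg']
  have e2 : torusDist (φ₁ + θ - (ϑ + θ) - π) = torusDist (ϑ₁ - φ₁ + (ϑ - ϑ₁) - π) := by
    rw [show φ₁ + θ - (ϑ + θ) - π = -(ϑ₁ - φ₁ + (ϑ - ϑ₁) - π) + (-1 : ℤ) * (2 * π) by push_cast; ring,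
      torusDist_add_int_mul_two_pi, torusDist_neg']
  rw [e1, e2]
  linarith

omit hr hK₂ hK₃ in
/-- **THE TRANSVERSAL NEAR-CAUSTIC WINDOW IN ONE CALL.**  `GeomConstants (frameLevel μ K) Kc r₀ g₀ w` (= `FrameOK` (i)), `|ρ| < r`, `|ρ| < r₀`, base point `c`,
base angle `θ`; box `[α,β] × [φa,φb]` (`φa ≤ φb`) with a witness `(ϑ₁,φ₁)`: `‖c + Φ(ρ,ϑ₁+θ) − 2Φ(0,φ₁+θ)‖ ≤ τ₀` and BOTH `‖ϑ₁ − φ₁‖_𝕋, ‖ϑ₁ − φ₁ − π‖_𝕋 ≥ η₀`;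
thresholds `τ₀ + msD₁((β−α)+(φb−φa)) ≤ Δ ≤ 3/10`, `K₁Δ < r`, `κ := κ(η₀ − (β−α), Δ, |ρ|) > 0` (the floor of `abs_configRate_ge_of_near`), `κ(β−α) ≤ Γ`; `F ≥ 0`
with the two-sided first-order law `F ≤ A₁(1 + log⁺(Γ/|δ₀|))²(1 + 1/√|δ₀|)` WHERE `δ₀(ϑ) ≠ 0`.  THEN
`∫_α^β F ≤ 2A₁·max(1, 1/√κ)·81(Γ/κ)^{1/4}·((β−α)^{3/4}/(3/4) + (β−α)^{1/4}/(1/4))`. -/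
theorem intervalIntegral_caustic_transversal_of_nearCaustic_le {Kc r₀ g₀ w : ℝ} (hG : GeomConstants (frameLevel μ K) Kc r₀ g₀ w) {ρ : ℝ} (hρ : |ρ| < r)
    (hρ₀ : |ρ| < r₀) (c : Momentum) (θ : ℝ) {α β φa φb ϑ₁ φ₁ τ₀ η₀ Δ Γ A₁ : ℝ} (hαβ : α ≤ β) (hφ : φa ≤ φb)
    (hϑ₁ : ϑ₁ ∈ Icc α β) (hφ₁ : φ₁ ∈ Icc φa φb)
    (hτ : ‖c + (levelPoint μ K ρ (ϑ₁ + θ) - levelPoint μ K 0 (φ₁ + θ)) - levelPoint μ K 0 (φ₁ + θ)‖ ≤ τ₀)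
    (htrans : η₀ ≤ min (torusDist (ϑ₁ - φ₁)) (torusDist (ϑ₁ - φ₁ - π)))
    (hΔ : τ₀ + msD A₃ A₄ 1 * ((β - α) + (φb - φa)) ≤ Δ) (hΔ1 : Δ ≤ 3 / 10) (hΔr : K₁ * Δ < r)
    (hκ : 0 < 2 / π * (((bandBounds (show (-4 : ℝ) < -1.1 by norm_num) (show (-1.1 : ℝ) ≤ -0.1 by norm_num) (show (-0.1 : ℝ) < 0 by norm_num)).Dtmin - 2 * A) *
        (bandBounds (show (-4 : ℝ) < -1.1 by norm_num) (show (-1.1 : ℝ) ≤ -0.1 by norm_num) (show (-0.1 : ℝ) < 0 by norm_num)).umin) *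
      ((bandBounds (show (-4 : ℝ) < -1.1 by norm_num) (show (-1.1 : ℝ) ≤ -0.1 by norm_num) (show (-0.1 : ℝ) < 0 by norm_num)).umin * w /
            (4 + 2 * A) *
          (η₀ - (β - α) - π / (2 * (bandBounds (show (-4 : ℝ) < -1.1 by norm_num) (show (-1.1 : ℝ) ≤ -0.1 by norm_num) (show (-0.1 : ℝ) < 0 by norm_num)).umin) * Δ) -
        π * Kc * (K₁ * Δ + |ρ|) / ((bandBounds (show (-4 : ℝ) < -1.1 by norm_num) (show (-1.1 : ℝ) ≤ -0.1 by norm_num)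
          (show (-0.1 : ℝ) < 0 by norm_num)).Dtmin - 2 * A) ^ 2))
    (hΓ : 2 / π * (((bandBounds (show (-4 : ℝ) < -1.1 by norm_num) (show (-1.1 : ℝ) ≤ -0.1 by norm_num) (show (-0.1 : ℝ) < 0 by norm_num)).Dtmin - 2 * A) *
        (bandBounds (show (-4 : ℝ) < -1.1 by norm_num) (show (-1.1 : ℝ) ≤ -0.1 by norm_num) (show (-0.1 : ℝ) < 0 by norm_num)).umin) *
      ((bandBounds (show (-4 : ℝ) < -1.1 by norm_num) (show (-1.1 : ℝ) ≤ -0.1 by norm_num) (show (-0.1 : ℝ) < 0 by norm_num)).umin * w /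
            (4 + 2 * A) *
          (η₀ - (β - α) - π / (2 * (bandBounds (show (-4 : ℝ) < -1.1 by norm_num) (show (-1.1 : ℝ) ≤ -0.1 by norm_num) (show (-0.1 : ℝ) < 0 by norm_num)).umin) * Δ) -
        π * Kc * (K₁ * Δ + |ρ|) / ((bandBounds (show (-4 : ℝ) < -1.1 by norm_num) (show (-1.1 : ℝ) ≤ -0.1 by norm_num)
          (show (-0.1 : ℝ) < 0 by norm_num)).Dtmin - 2 * A) ^ 2) * (β - α) ≤ Γ)
    {F : ℝ → ℝ} (hA₁ : 0 ≤ A₁) (hF0 : ∀ ϑ ∈ Icc α β, 0 ≤ F ϑ)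
    (hFlaw : ∀ ϑ ∈ Ioo α β, sInf ((fun φ => frameLevel μ K (c + (levelPoint μ K ρ (ϑ + θ) - levelPoint μ K 0 (φ + θ)))) '' Icc φa φb) ≠ 0 →
      F ϑ ≤ A₁ * ((1 + log⁺ (Γ / |sInf ((fun φ => frameLevel μ K (c + (levelPoint μ K ρ (ϑ + θ) - levelPoint μ K 0 (φ + θ)))) '' Icc φa φb)|)) ^ 2 *
        (1 + (Real.sqrt |sInf ((fun φ => frameLevel μ K (c + (levelPoint μ K ρ (ϑ + θ) - levelPoint μ K 0 (φ + θ)))) '' Icc φa φb)|)⁻¹))) :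
    ∫ ϑ in α..β, F ϑ ≤ 2 * (A₁ * max 1 (Real.sqrt (2 / π * (((bandBounds (show (-4 : ℝ) < -1.1 by norm_num) (show (-1.1 : ℝ) ≤ -0.1 by norm_num) (show (-0.1 : ℝ) < 0 by norm_num)).Dtmin - 2 * A) *
        (bandBounds (show (-4 : ℝ) < -1.1 by norm_num) (show (-1.1 : ℝ) ≤ -0.1 by norm_num) (show (-0.1 : ℝ) < 0 by norm_num)).umin) *
      ((bandBounds (show (-4 : ℝ) < -1.1 by norm_num) (show (-1.1 : ℝ) ≤ -0.1 by norm_num) (show (-0.1 : ℝ) < 0 by norm_num)).umin * w /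
            (4 + 2 * A) *
          (η₀ - (β - α) - π / (2 * (bandBounds (show (-4 : ℝ) < -1.1 by norm_num) (show (-1.1 : ℝ) ≤ -0.1 by norm_num) (show (-0.1 : ℝ) < 0 by norm_num)).umin) * Δ) -
        π * Kc * (K₁ * Δ + |ρ|) / ((bandBounds (show (-4 : ℝ) < -1.1 by norm_num) (show (-1.1 : ℝ) ≤ -0.1 by norm_num)
          (show (-0.1 : ℝ) < 0 by norm_num)).Dtmin - 2 * A) ^ 2)))⁻¹ *
      (81 * (Γ / (2 / π * (((bandBounds (show (-4 : ℝ) < -1.1 by norm_num) (show (-1.1 : ℝ) ≤ -0.1 by norm_num) (show (-0.1 : ℝ) < 0 by norm_num)).Dtmin - 2 * A) *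
        (bandBounds (show (-4 : ℝ) < -1.1 by norm_num) (show (-1.1 : ℝ) ≤ -0.1 by norm_num) (show (-0.1 : ℝ) < 0 by norm_num)).umin) *
      ((bandBounds (show (-4 : ℝ) < -1.1 by norm_num) (show (-1.1 : ℝ) ≤ -0.1 by norm_num) (show (-0.1 : ℝ) < 0 by norm_num)).umin * w /
            (4 + 2 * A) *
          (η₀ - (β - α) - π / (2 * (bandBounds (show (-4 : ℝ) < -1.1 by norm_num) (show (-1.1 : ℝ) ≤ -0.1 by norm_num) (show (-0.1 : ℝ) < 0 by norm_num)).umin) * Δ) -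
        π * Kc * (K₁ * Δ + |ρ|) / ((bandBounds (show (-4 : ℝ) < -1.1 by norm_num) (show (-1.1 : ℝ) ≤ -0.1 by norm_num)
          (show (-0.1 : ℝ) < 0 by norm_num)).Dtmin - 2 * A) ^ 2))) ^ (1 / 4 : ℝ)) *
      ((β - α) ^ (3 / 4 : ℝ) / (3 / 4) + (β - α) ^ (1 / 4 : ℝ) / (1 / 4))) := by
  -- the `hΔ` row with `ψ = φ₁ + θ`, the angular separation on the window, the two-point separation of the offset
  have hbox : ∀ x ∈ Icc α β ×ˢ Icc φa φb, ‖c + (levelPoint μ K ρ (x.1 + θ) - levelPoint μ K 0 (x.2 + θ)) - levelPoint μ K 0 (φ₁ + θ)‖ ≤ Δ := fun x hx =>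
    (norm_partnerBand_sub_loopPoint_le_of_nearCaustic_box hA hA20 hd hlo hhi hA₃ hA₄ hρ c θ hϑ₁ hφ₁ hτ x hx).trans hΔ
  have hη := angularSeparation_of_witness (θ := θ) hϑ₁ htrans
  have hsep := abs_windowMin_sub_ge_of_transversal_sInf hA hd hlo hhi hK₁ hG hρ hρ₀ c θ (φ₁ + θ) hφ hbox hΔ1 hΔr hη hκ
  have hcont := continuousOn_sInf_partnerBand hA hd hlo hhi hρ c θ φa φb (Icc α β)
  exact intervalIntegral_caustic_dispatch_transversal_le hαβ hκ hA₁ hΓ hcont hsep hF0 hFlaw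

/-! ## §3 The cover theorem: every near-caustic window of an umklapp sheet is one call, the trichotomy decided inside -/

omit hr in
/-- **THE COVER THEOREM (memo U1-CAUSTIC-SUP §9 (3)).**  `FrameOK`, `|ρ| < r`, `|ρ| < 3/80`, base angle `θ`, umklapp sheet `m ≠ 0` (base point `c = Φ(0,θ) − 2πm`);
a ϑ-window `[α,β]` and a loop window `[φa,φb]` with a NEAR-CAUSTIC witness `(ϑ₁,φ₁)`: `‖c + Φ(ρ,ϑ₁+θ) − 2Φ(0,φ₁+θ)‖ ≤ τ₀`; n-free thresholds
`(τ₀, η₀, Δ, ω, Γ)` with the SAME-DIRECTION budget `τ₀ + 2(msD₁η₀ + |ρ|/(Dt−2A)) ≤ 3/5`, the TRANSVERSAL data (`τ₀ + msD₁((β−α)+(φb−φa)) ≤ Δ ≤ 3/10`, `K₁Δ < r`,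
`κ := κ(η₀ − (β−α), Δ, |ρ|) > 0`, `κ(β−α) ≤ Γ`) and the ANTIPODAL data (`η₀ + (β−α) ≤ ω`, `φb − φa ≤ ω`, budget `2ε(Δ,|ρ|,ω) < (9/400)u_min²`); `F ≥ 0`, `R ≥ 0`
integrable; the three first-order laws keyed to the canonical offset `δ₀(ϑ) = inf_{φ ∈ [φa,φb]} e_K(c + Φ(ρ,ϑ+θ) − Φ(0,φ+θ))`: two-sided WHERE `δ₀ ≠ 0`, pre WHERE
`δ₀ > 0`, log-free post WHERE `δ₀ < 0`.  THEN `∫_α^β F ≤ max(b_trans, b_anti)` — whether the window is transversal or antipodal (same-direction being empty) is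
decided INSIDE (`not_nearCaustic_sameDirection` / `intervalIntegral_caustic_transversal_of_nearCaustic_le` / `intervalIntegral_caustic_antipodal_of_nearCaustic_le`);
the caller never supplies a case, a crossing, a zero pair or a fold angle. -/
theorem intervalIntegral_caustic_nearCaustic_umklapp_le {R : RenConsts} {U : ℝ} {N : ℕ} (hF : FrameOK R U N μ K) {ρ : ℝ} (hρ : |ρ| < r) (hρ₀ : |ρ| < 3 / 80)
    (θ : ℝ) {m : Fin 2 → ℤ} (hm : m ≠ 0) {α β φa φb ϑ₁ φ₁ τ₀ η₀ Δ ω Γ A₁ : ℝ} (hαβ : α ≤ β) (hφ : φa ≤ φb) (hϑ₁ : ϑ₁ ∈ Icc α β) (hφ₁ : φ₁ ∈ Icc φa φb)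
    (hτ : ‖levelPoint μ K 0 θ - WithLp.toLp 2 (fun i => 2 * π * (m i : ℝ)) + (levelPoint μ K ρ (ϑ₁ + θ) - levelPoint μ K 0 (φ₁ + θ)) -
      levelPoint μ K 0 (φ₁ + θ)‖ ≤ τ₀)
    (hsame : τ₀ + 2 * (msD A₃ A₄ 1 * η₀ + |ρ| / ((bandBounds (show (-4 : ℝ) < -1.1 by norm_num) (show (-1.1 : ℝ) ≤ -0.1 by norm_num) (show (-0.1 : ℝ) < 0 by norm_num)).Dtmin - 2 * A)) ≤ 3 / 5)
    (hΔ : τ₀ + msD A₃ A₄ 1 * ((β - α) + (φb - φa)) ≤ Δ) (hΔ1 : Δ ≤ 3 / 10) (hΔr : K₁ * Δ < r) (hω₁ : η₀ + (β - α) ≤ ω) (hω₂ : φb - φa ≤ ω)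
    (hκ : 0 < 2 / π * (((bandBounds (show (-4 : ℝ) < -1.1 by norm_num) (show (-1.1 : ℝ) ≤ -0.1 by norm_num) (show (-0.1 : ℝ) < 0 by norm_num)).Dtmin - 2 * A) * (bandBounds (show (-4 : ℝ) < -1.1 by norm_num) (show (-1.1 : ℝ) ≤ -0.1 by norm_num) (show (-0.1 : ℝ) < 0 by norm_num)).umin) *
      ((bandBounds (show (-4 : ℝ) < -1.1 by norm_num) (show (-1.1 : ℝ) ≤ -0.1 by norm_num) (show (-0.1 : ℝ) < 0 by norm_num)).umin * (3 / 200) / (4 + 2 * A) * (η₀ - (β - α) - π / (2 * (bandBounds (show (-4 : ℝ) < -1.1 by norm_num) (show (-1.1 : ℝ) ≤ -0.1 by norm_num) (show (-0.1 : ℝ) < 0 by norm_num)).umin) * Δ) - π * 7 * (K₁ * Δ + |ρ|) / ((bandBounds (show (-4 : ℝ) < -1.1 by norm_num) (show (-1.1 : ℝ) ≤ -0.1 by norm_num) (show (-0.1 : ℝ) < 0 by norm_num)).Dtmin - 2 * A) ^ 2))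
    (hΓ : 2 / π * (((bandBounds (show (-4 : ℝ) < -1.1 by norm_num) (show (-1.1 : ℝ) ≤ -0.1 by norm_num) (show (-0.1 : ℝ) < 0 by norm_num)).Dtmin - 2 * A) * (bandBounds (show (-4 : ℝ) < -1.1 by norm_num) (show (-1.1 : ℝ) ≤ -0.1 by norm_num) (show (-0.1 : ℝ) < 0 by norm_num)).umin) *
      ((bandBounds (show (-4 : ℝ) < -1.1 by norm_num) (show (-1.1 : ℝ) ≤ -0.1 by norm_num) (show (-0.1 : ℝ) < 0 by norm_num)).umin * (3 / 200) / (4 + 2 * A) * (η₀ - (β - α) - π / (2 * (bandBounds (show (-4 : ℝ) < -1.1 by norm_num) (show (-1.1 : ℝ) ≤ -0.1 by norm_num) (show (-0.1 : ℝ) < 0 by norm_num)).umin) * Δ) - π * 7 * (K₁ * Δ + |ρ|) / ((bandBounds (show (-4 : ℝ) < -1.1 by norm_num) (show (-1.1 : ℝ) ≤ -0.1 by norm_num) (show (-0.1 : ℝ) < 0 by norm_num)).Dtmin - 2 * A) ^ 2) * (β - α) ≤ Γ)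
    (hbudget : 2 * (2 * K₃ * Δ * msD A₃ A₄ 1 ^ 2 +
        4 * K₂ * (radialRowOneConst A ((bandBounds (show (-4 : ℝ) < -1.1 by norm_num) (show (-1.1 : ℝ) ≤ -0.1 by norm_num) (show (-0.1 : ℝ) < 0 by norm_num)).Dtmin - 2 * A) * |ρ| + msD A₃ A₄ 2 * ω) * msD A₃ A₄ 1 +
        K₂ * Δ * msD A₃ A₄ 2 +
        K₁ * ((uRowTwoConst A A₃ ((bandBounds (show (-4 : ℝ) < -1.1 by norm_num) (show (-1.1 : ℝ) ≤ -0.1 by norm_num) (show (-0.1 : ℝ) < 0 by norm_num)).Dtmin - 2 * A) + 1 / ((bandBounds (show (-4 : ℝ) < -1.1 by norm_num) (show (-1.1 : ℝ) ≤ -0.1 by norm_num) (show (-0.1 : ℝ) < 0 by norm_num)).Dtmin - 2 * A) +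
              2 * (radialRowOneConst A ((bandBounds (show (-4 : ℝ) < -1.1 by norm_num) (show (-1.1 : ℝ) ≤ -0.1 by norm_num) (show (-0.1 : ℝ) < 0 by norm_num)).Dtmin - 2 * A) - 1 / ((bandBounds (show (-4 : ℝ) < -1.1 by norm_num) (show (-1.1 : ℝ) ≤ -0.1 by norm_num) (show (-0.1 : ℝ) < 0 by norm_num)).Dtmin - 2 * A))) * |ρ| + msD A₃ A₄ 3 * ω)) < 9 / 400 * (bandBounds (show (-4 : ℝ) < -1.1 by norm_num) (show (-1.1 : ℝ) ≤ -0.1 by norm_num) (show (-0.1 : ℝ) < 0 by norm_num)).umin ^ 2)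
    {F Rm : ℝ → ℝ} {lo A' P B : ℝ} (hlo' : 0 < lo) (hA' : 0 ≤ A') (hP : 0 ≤ P) (hB : 0 ≤ B) (hA₁ : 0 ≤ A₁)
    (hF0 : ∀ ϑ ∈ Icc α β, 0 ≤ F ϑ) (hR0 : ∀ ϑ ∈ Icc α β, 0 ≤ Rm ϑ) (hRi : IntervalIntegrable Rm volume α β)
    (hFlaw : ∀ ϑ ∈ Ioo α β, sInf ((fun φ => frameLevel μ K (levelPoint μ K 0 θ - WithLp.toLp 2 (fun i => 2 * π * (m i : ℝ)) + (levelPoint μ K ρ (ϑ + θ) - levelPoint μ K 0 (φ + θ)))) '' Icc φa φb) ≠ 0 →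
      F ϑ ≤ A₁ * ((1 + log⁺ (Γ / |sInf ((fun φ => frameLevel μ K (levelPoint μ K 0 θ - WithLp.toLp 2 (fun i => 2 * π * (m i : ℝ)) + (levelPoint μ K ρ (ϑ + θ) - levelPoint μ K 0 (φ + θ)))) '' Icc φa φb)|)) ^ 2 * (1 + (Real.sqrt |sInf ((fun φ => frameLevel μ K (levelPoint μ K 0 θ - WithLp.toLp 2 (fun i => 2 * π * (m i : ℝ)) + (levelPoint μ K ρ (ϑ + θ) - levelPoint μ K 0 (φ + θ)))) '' Icc φa φb)|)⁻¹)))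
    (hpre : ∀ ϑ ∈ Ioo α β, 0 < sInf ((fun φ => frameLevel μ K (levelPoint μ K 0 θ - WithLp.toLp 2 (fun i => 2 * π * (m i : ℝ)) + (levelPoint μ K ρ (ϑ + θ) - levelPoint μ K 0 (φ + θ)))) '' Icc φa φb) →
      F ϑ ≤ A' * (lo * ((max |sInf ((fun φ => frameLevel μ K (levelPoint μ K 0 θ - WithLp.toLp 2 (fun i => 2 * π * (m i : ℝ)) + (levelPoint μ K ρ (ϑ + θ) - levelPoint μ K 0 (φ + θ)))) '' Icc φa φb)| lo)⁻¹ * (Real.sqrt (max |sInf ((fun φ => frameLevel μ K (levelPoint μ K 0 θ - WithLp.toLp 2 (fun i => 2 * π * (m i : ℝ)) + (levelPoint μ K ρ (ϑ + θ) - levelPoint μ K 0 (φ + θ)))) '' Icc φa φb)| lo))⁻¹)) + B + Rm ϑ)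
    (hpost : ∀ ϑ ∈ Ioo α β, sInf ((fun φ => frameLevel μ K (levelPoint μ K 0 θ - WithLp.toLp 2 (fun i => 2 * π * (m i : ℝ)) + (levelPoint μ K ρ (ϑ + θ) - levelPoint μ K 0 (φ + θ)))) '' Icc φa φb) < 0 →
      F ϑ ≤ P * (Real.sqrt |sInf ((fun φ => frameLevel μ K (levelPoint μ K 0 θ - WithLp.toLp 2 (fun i => 2 * π * (m i : ℝ)) + (levelPoint μ K ρ (ϑ + θ) - levelPoint μ K 0 (φ + θ)))) '' Icc φa φb)|)⁻¹ + B + Rm ϑ) :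
    ∫ ϑ in α..β, F ϑ ≤ max (2 * (A₁ * max 1 (Real.sqrt (2 / π * (((bandBounds (show (-4 : ℝ) < -1.1 by norm_num) (show (-1.1 : ℝ) ≤ -0.1 by norm_num) (show (-0.1 : ℝ) < 0 by norm_num)).Dtmin - 2 * A) * (bandBounds (show (-4 : ℝ) < -1.1 by norm_num) (show (-1.1 : ℝ) ≤ -0.1 by norm_num) (show (-0.1 : ℝ) < 0 by norm_num)).umin) *
      ((bandBounds (show (-4 : ℝ) < -1.1 by norm_num) (show (-1.1 : ℝ) ≤ -0.1 by norm_num) (show (-0.1 : ℝ) < 0 by norm_num)).umin * (3 / 200) / (4 + 2 * A) * (η₀ - (β - α) - π / (2 * (bandBounds (show (-4 : ℝ) < -1.1 by norm_num) (show (-1.1 : ℝ) ≤ -0.1 by norm_num) (show (-0.1 : ℝ) < 0 by norm_num)).umin) * Δ) - π * 7 * (K₁ * Δ + |ρ|) / ((bandBounds (show (-4 : ℝ) < -1.1 by norm_num) (show (-1.1 : ℝ) ≤ -0.1 by norm_num) (show (-0.1 : ℝ) < 0 by norm_num)).Dtmin - 2 * A) ^ 2)))⁻¹ * (81 * (Γ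 / (2 / π * (((bandBounds (show (-4 : ℝ) < -1.1 by norm_num) (show (-1.1 : ℝ) ≤ -0.1 by norm_num) (show (-0.1 : ℝ) < 0 by norm_num)).Dtmin - 2 * A) * (bandBounds (show (-4 : ℝ) < -1.1 by norm_num) (show (-1.1 : ℝ) ≤ -0.1 by norm_num) (show (-0.1 : ℝ) < 0 by norm_num)).umin) *
      ((bandBounds (show (-4 : ℝ) < -1.1 by norm_num) (show (-1.1 : ℝ) ≤ -0.1 by norm_num) (show (-0.1 : ℝ) < 0 by norm_num)).umin * (3 / 200) / (4 + 2 * A) * (η₀ - (β - α) - π / (2 * (bandBounds (show (-4 : ℝ) < -1.1 by norm_num) (show (-1.1 : ℝ) ≤ -0.1 by norm_num) (show (-0.1 : ℝ) < 0 by norm_num)).umin) * Δ) - π * 7 * (K₁ * Δ + |ρ|) / ((bandBounds (show (-4 : ℝ) < -1.1 by norm_num) (show (-1.1 : ℝ) ≤ -0.1 by norm_num) (show (-0.1 : ℝ) < 0 by norm_num)).Dtmin - 2 * A) ^ 2))) ^ (1 / 4 : ℝ)) *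
          ((β - α) ^ (3 / 4 : ℝ) / (3 / 4) + (β - α) ^ (1 / 4 : ℝ) / (1 / 4))))
      ((8 * A' + 4 * P) / Real.sqrt ((9 / 400 * (bandBounds (show (-4 : ℝ) < -1.1 by norm_num) (show (-1.1 : ℝ) ≤ -0.1 by norm_num) (show (-0.1 : ℝ) < 0 by norm_num)).umin ^ 2 - 2 * (2 * K₃ * Δ * msD A₃ A₄ 1 ^ 2 +
        4 * K₂ * (radialRowOneConst A ((bandBounds (show (-4 : ℝ) < -1.1 by norm_num) (show (-1.1 : ℝ) ≤ -0.1 by norm_num) (show (-0.1 : ℝ) < 0 by norm_num)).Dtmin - 2 * A) * |ρ| + msD A₃ A₄ 2 * ω) * msD A₃ A₄ 1 +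
        K₂ * Δ * msD A₃ A₄ 2 +
        K₁ * ((uRowTwoConst A A₃ ((bandBounds (show (-4 : ℝ) < -1.1 by norm_num) (show (-1.1 : ℝ) ≤ -0.1 by norm_num) (show (-0.1 : ℝ) < 0 by norm_num)).Dtmin - 2 * A) + 1 / ((bandBounds (show (-4 : ℝ) < -1.1 by norm_num) (show (-1.1 : ℝ) ≤ -0.1 by norm_num) (show (-0.1 : ℝ) < 0 by norm_num)).Dtmin - 2 * A) +
              2 * (radialRowOneConst A ((bandBounds (show (-4 : ℝ) < -1.1 by norm_num) (show (-1.1 : ℝ) ≤ -0.1 by norm_num) (show (-0.1 : ℝ) < 0 by norm_num)).Dtmin - 2 * A) - 1 / ((bandBounds (show (-4 : ℝ) < -1.1 by norm_num) (show (-1.1 : ℝ) ≤ -0.1 by norm_num) (show (-0.1 : ℝ) < 0 by norm_num)).Dtmin - 2 * A))) * |ρ| + msD A₃ A₄ 3 * ω))) / 2) + B * (β - α) + ∫ ϑ in α..β, Rm ϑ) := by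
  set c : Momentum := levelPoint μ K 0 θ - WithLp.toLp 2 (fun i => 2 * π * (m i : ℝ)) with hc
  have hr' : 0 < r := lt_of_le_of_lt (abs_nonneg ρ) hρ
  rcases le_or_gt (torusDist (ϑ₁ - φ₁)) η₀ with hs | hs
  · -- same direction: empty
    exfalso
    have hτ' : ‖pairSumPath μ K ρ ϑ₁ θ 0 - WithLp.toLp 2 (fun i => 2 * π * (m i : ℝ)) - (2 : ℝ) • levelPoint μ K 0 (φ₁ + θ)‖ ≤ τ₀ := by
      have e : pairSumPath μ K ρ ϑ₁ θ 0 - WithLp.toLp 2 (fun i => 2 * π * (m i : ℝ)) - (2 : ℝ) • levelPoint μ K 0 (φ₁ + θ) =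
          c + (levelPoint μ K ρ (ϑ₁ + θ) - levelPoint μ K 0 (φ₁ + θ)) - levelPoint μ K 0 (φ₁ + θ) := by
        simp only [pairSumPath, add_zero, two_smul, hc]; abel
      rw [e]; exact hτ
    exact not_nearCaustic_sameDirection hA hA20 hd hr' hlo hhi hA₃ hA₄ hρ θ hm hτ' hs hsame
  rcases le_or_gt (torusDist (ϑ₁ - φ₁ - π)) η₀ with ha | ha
  · -- antipodal
    exact le_max_of_le_right (intervalIntegral_caustic_antipodal_of_nearCaustic_le hA hA20 hd hr' hlo hhi hA₃ hA₄ hK₁ hK₂ hK₃ hF hρ c θ hαβ hφ hϑ₁ hφ₁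
      hτ ha hΔ hω₁ hω₂ hbudget hlo' hA' hP hB hF0 hR0 hRi hpre hpost)
  · -- transversal
    have htrans : η₀ ≤ min (torusDist (ϑ₁ - φ₁)) (torusDist (ϑ₁ - φ₁ - π)) := le_min hs.le ha.le
    exact le_max_of_le_left (intervalIntegral_caustic_transversal_of_nearCaustic_le hA hA20 hd hlo hhi hA₃ hA₄ hK₁ hF.1 hρ hρ₀ c θ hαβ hφ hϑ₁ hφ₁
      hτ htrans hΔ hΔ1 hΔr hκ hΓ hA₁ hF0 hFlaw)

end Sizes

end Summit.HubbardSuperconductivity.HubbardSuperconductivity.Theorems.C4a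

end
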